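import Literature.AlgebraicGeometry.HodgeTheory.GlZariskiClosureGroup
import Mathlib.LinearAlgebra.PerfectPairing.Basic
import HarnessLib

/-!
# The transpose of an endomorphism through a perfect pairing, and the contragredient of an
# automorphism — in coordinates `G⁻¹ Aᵀ G`, entries in `K[x, 1/det]` (Katz 1990 §1.8: "the representations
# `(ρᵢ)^*`"; Borel I.1.7)

Family `hodge`, layer `Literature/AlgebraicGeometry/HodgeTheory`. One DEFINITION (`pairingTranspose`) and
THEOREMS. Layer L1 of hole S6 ("block section") of the lane-D glue of crux K1 `VeryGeneralDeckCommutatorsInHg`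
(`stmt-HodgeConjecture-19544`, memo LANE-D-ROADMAP-v2-Ax-g0 §2 S6): an automorphism of `V ⊗ ℂ` preserving the
eigenspaces of the deck transformation and the intersection form is determined on `H(ζ^{-j})` by its block on
`H(ζ^{j})` through the perfect pairing `B_ℂ : H(ζ^j) × H(ζ^{-j}) → ℂ` — as the CONTRAGREDIENT, whose matrix
is `G⁻¹ ([u]⁻¹)ᵀ G`, a matrix with entries in `ℂ[x, 1/det x]` (the shape the Zariski-closure transport
`map_mem_glIdentityComponent_of_evalAtInvDet` / `mem_glIdentityComponent_of_rationalMap` consumes).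
Written by the prover seat `hodge-nonav-prover-A` (cell `hodge-nonav`).

## What is here (`K` a field; `β : P →ₗ Q →ₗ K` a perfect pairing of finite-dimensional spaces,
## Mathlib `LinearMap.IsPerfPair`)
* `pairingTranspose β a : Q →ₗ[K] Q` (DEFINITION) — the `β`-transpose of `a : P →ₗ[K] P`:
  `β x (aᵗ y) = β (a x) y` (`apply_pairingTranspose`); uniqueness `eq_pairingTranspose`; `pairingTranspose_one`,
  `pairingTranspose_mul` (an anti-homomorphism).
* `pairingTranspose_symm_eq_of_isometry` — if `β (f x) (g y) = β x y` (`f ∈ GL(P)`, `g ∈ GL(Q)`), then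
  `g = (f⁻¹)ᵗ`: the CONTRAGREDIENT ("`(ρ^*)(s) = ((ρ s)⁻¹)ᵗ`", Katz's hypothesis (4)).
* `gram_mul_toMatrix_pairingTranspose` — in bases `b, c`: `G · [aᵗ]_c = ([a]_b)ᵀ · G`, `G_{kl} = β(b_k, c_l)`;
  `isUnit_det_gram` (square Gram matrices of a perfect pairing are invertible) and
  `toMatrix_pairingTranspose = G⁻¹ ([a]_b)ᵀ G`.
* `isPerfPair_of_separating` — a pairing of finite-dimensional spaces separating on both sides is perfect.

## References
* [Katz1990ESDE] N. M. Katz, *Exponential Sums and Differential Equations*, Ann. of Math. Stud. 124 (1990),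
  §1.8 Prop. 1.8.2 (the contragredient representations `(ρᵢ)^*`, hypothesis (4)).
* [Borel1991] A. Borel, *Linear Algebraic Groups*, 2nd ed., GTM 126 (1991), I.1.7 (`K[GL_n] = K[x, 1/det]`).
-/

noncomputable section

open Module Matrix

namespace Literature.AlgebraicGeometry.HodgeTheory

universe u v w

variable {K : Type u} [Field K] {P : Type v} [AddCommGroup P] [Module K P] {Q : Type w} [AddCommGroup Q]
  [Module K Q]

/-! ### §1 The `β`-transpose -/

section Transpose

variable (β : P →ₗ[K] Q →ₗ[K] K) [β.IsPerfPair]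

/-- **The `β`-transpose** of an endomorphism `a` of `P` through a perfect pairing `β : P × Q → K`: the unique
endomorphism `aᵗ` of `Q` with `β x (aᵗ y) = β (a x) y` (transport of `a^* = Module.Dual`-transpose along
`Q ≃ Dual P`). [cite: Katz1990ESDE, §1.8 Prop. 1.8.2] -/
def pairingTranspose (a : P →ₗ[K] P) : Q →ₗ[K] Q :=
  (β.flip.toPerfPair.symm : Dual K P →ₗ[K] Q) ∘ₗ a.dualMap ∘ₗ (β.flip.toPerfPair : Q →ₗ[K] Dual K P)

/-- The defining identity `β x (aᵗ y) = β (a x) y`. [cite: Katz1990ESDE, §1.8 Prop. 1.8.2] -/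
@[simp] theorem apply_pairingTranspose (a : P →ₗ[K] P) (x : P) (y : Q) :
    β x (pairingTranspose β a y) = β (a x) y := by
  have h : β.flip (pairingTranspose β a y) = a.dualMap (β.flip.toPerfPair y) := by
    change β.flip (β.flip.toPerfPair.symm (a.dualMap (β.flip.toPerfPair y))) = _
    exact β.flip.apply_symm_toPerfPair_self _
  have h2 := congrArg (fun φ : Dual K P => φ x) h
  simpa using h2

/-- **Uniqueness**: an endomorphism `g` of `Q` with `β x (g y) = β (a x) y` for all `x, y` is `aᵗ`.
[cite: Katz1990ESDE, §1.8 Prop. 1.8.2] -/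
theorem eq_pairingTranspose {a : P →ₗ[K] P} {g : Q →ₗ[K] Q} (h : ∀ x y, β x (g y) = β (a x) y) :
    g = pairingTranspose β a := by
  refine LinearMap.ext fun y => (LinearMap.IsPerfPair.bijective_left β.flip).1 (LinearMap.ext fun x => ?_)
  rw [LinearMap.flip_apply, LinearMap.flip_apply, h, apply_pairingTranspose]

/-- `1ᵗ = 1`. [cite: Katz1990ESDE, §1.8 Prop. 1.8.2] -/
theorem pairingTranspose_one : pairingTranspose β (1 : P →ₗ[K] P) = 1 :=
  (eq_pairingTranspose β fun _ _ => rfl).symm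

/-- `(a b)ᵗ = bᵗ aᵗ`. [cite: Katz1990ESDE, §1.8 Prop. 1.8.2] -/
theorem pairingTranspose_mul (a b : P →ₗ[K] P) :
    pairingTranspose β (a * b) = pairingTranspose β b * pairingTranspose β a :=
  (eq_pairingTranspose β fun x y => by
    rw [Module.End.mul_apply, apply_pairingTranspose, apply_pairingTranspose, Module.End.mul_apply]).symm

/-- **The contragredient**: if automorphisms `f` of `P` and `g` of `Q` preserve the pairing,
`β (f x) (g y) = β x y`, then `g = (f⁻¹)ᵗ`. [cite: Katz1990ESDE, §1.8 Prop. 1.8.2] -/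
theorem pairingTranspose_symm_eq_of_isometry {f : P ≃ₗ[K] P} {g : Q ≃ₗ[K] Q}
    (h : ∀ x y, β (f x) (g y) = β x y) : (g : Q →ₗ[K] Q) = pairingTranspose β (f.symm : P →ₗ[K] P) := by
  refine eq_pairingTranspose β fun x y => ?_
  have h1 := h (f.symm x) y
  rw [LinearEquiv.apply_symm_apply] at h1
  simpa using h1

end Transpose

/-! ### §2 Coordinates: `G [aᵗ] = [a]ᵀ G` -/

section Matrices

variable (β : P →ₗ[K] Q →ₗ[K] K) [β.IsPerfPair]
variable {κ : Type*} [Fintype κ] [DecidableEq κ] {κ' : Type*} [Fintype κ'] [DecidableEq κ']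

/-- **`G · [aᵗ]_c = ([a]_b)ᵀ · G`** with the Gram matrix `G_{kl} = β (b k) (c l)`. [cite: Borel1991, I.1.7] -/
theorem gram_mul_toMatrix_pairingTranspose (b : Basis κ K P) (c : Basis κ' K Q) (a : P →ₗ[K] P) :
    Matrix.of (fun k l => β (b k) (c l)) * LinearMap.toMatrix c c (pairingTranspose β a) =
      (LinearMap.toMatrix b b a)ᵀ * Matrix.of (fun k l => β (b k) (c l)) := by
  ext k l
  have hl : pairingTranspose β a (c l) = ∑ m, LinearMap.toMatrix c c (pairingTranspose β a) m l • c m := by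
    simp_rw [LinearMap.toMatrix_apply]
    exact (c.sum_repr _).symm
  have hk : a (b k) = ∑ m, LinearMap.toMatrix b b a m k • b m := by
    simp_rw [LinearMap.toMatrix_apply]
    exact (b.sum_repr _).symm
  have key := apply_pairingTranspose β a (b k) (c l)
  rw [hl, hk, map_sum, LinearMap.map_sum₂] at key
  simp only [map_smul, smul_eq_mul] at key
  simp only [Matrix.mul_apply, Matrix.of_apply, Matrix.transpose_apply]
  calc ∑ m, β (b k) (c m) * LinearMap.toMatrix c c (pairingTranspose β a) m l
      = ∑ m, LinearMap.toMatrix c c (pairingTranspose β a) m l * β (b k) (c m) :=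
        Finset.sum_congr rfl fun m _ => mul_comm _ _
    _ = ∑ m, LinearMap.toMatrix b b a m k * β (b m) (c l) := key

/-- **The (square) Gram matrix of a perfect pairing is invertible.** [cite: Borel1991, I.1.7] -/
theorem isUnit_det_gram (b : Basis κ K P) (c : Basis κ K Q) :
    IsUnit (Matrix.of (fun k l => β (b k) (c l))).det := by
  classical
  rw [isUnit_iff_ne_zero]
  intro hdet
  obtain ⟨v, hv0, hv⟩ := Matrix.exists_mulVec_eq_zero_iff.2 hdet
  -- `y := Σ v_l c_l` pairs to zero with every `b k`, hence with everything, hence `y = 0`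
  set y : Q := ∑ l, v l • c l with hy
  have hby : ∀ k, β (b k) y = 0 := fun k => by
    have h := congrFun hv k
    simp only [Matrix.mulVec, dotProduct, Matrix.of_apply, Pi.zero_apply] at h
    rw [hy, map_sum]
    simp only [map_smul, smul_eq_mul]
    simpa only [mul_comm] using h
  have hxy : ∀ x, β x y = 0 := fun x => by
    rw [← b.sum_repr x, LinearMap.map_sum₂]
    simp only [LinearMap.map_smul₂, hby, smul_eq_mul, mul_zero, Finset.sum_const_zero]
  have hy0 : y = 0 := by
    refine (LinearMap.IsPerfPair.bijective_left β.flip).1 (LinearMap.ext fun x => ?_)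
    rw [LinearMap.flip_apply, hxy, map_zero, LinearMap.zero_apply]
  apply hv0
  have h : c.equivFun.symm v = 0 := by rw [Basis.equivFun_symm_apply, ← hy, hy0]
  exact c.equivFun.symm.map_eq_zero_iff.mp h

/-- **`[aᵗ]_c = G⁻¹ ([a]_b)ᵀ G`** (square bases). [cite: Borel1991, I.1.7] -/
theorem toMatrix_pairingTranspose (b : Basis κ K P) (c : Basis κ K Q) (a : P →ₗ[K] P) :
    LinearMap.toMatrix c c (pairingTranspose β a) =
      (Matrix.of (fun k l => β (b k) (c l)))⁻¹ * (LinearMap.toMatrix b b a)ᵀ * Matrix.of (fun k l => β (b k) (c l)) := by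
  have hG := isUnit_det_gram β b c
  rw [Matrix.mul_assoc, ← gram_mul_toMatrix_pairingTranspose β b c a, ← Matrix.mul_assoc,
    Matrix.nonsing_inv_mul _ hG, Matrix.one_mul]

end Matrices

/-! ### §3 Perfectness from two-sided separation -/

/-- A pairing of finite-dimensional spaces that separates points on both sides is perfect (Mathlib
`LinearMap.IsPerfPair.of_injective`). [cite: Borel1991, I.1.7] -/
theorem isPerfPair_of_separating [FiniteDimensional K P] (β : P →ₗ[K] Q →ₗ[K] K)
    (hl : ∀ x, (∀ y, β x y = 0) → x = 0) (hr : ∀ y, (∀ x, β x y = 0) → y = 0) : β.IsPerfPair := by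
  refine LinearMap.IsPerfPair.of_injective (fun x x' h => ?_) (fun y y' h => ?_)
  · rw [← sub_eq_zero]
    refine hl _ fun y => ?_
    rw [map_sub, LinearMap.sub_apply, sub_eq_zero]
    exact congrArg (fun φ : Q →ₗ[K] K => φ y) h
  · rw [← sub_eq_zero]
    refine hr _ fun x => ?_
    rw [map_sub, sub_eq_zero]
    exact congrArg (fun φ : P →ₗ[K] K => φ x) h

end Literature.AlgebraicGeometry.HodgeTheory

end
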